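import Literature.Geometry.Lorentzian.KillingHorizonShadowAlong
import Literature.Geometry.Lorentzian.KillingAlgebraAsymptoticallyFlat
import Literature.Geometry.Lorentzian.AxisymmetricBlackHoleUniquenessProofs
import Literature.Geometry.Lorentzian.StaticBlackHoleUniquenessProofs
import Literature.Geometry.Lorentzian.LorentzianMetricProofs
import Literature.Geometry.Lorentzian.CausalityOpennessProofs

/-!
# Stub `stub_axialCollar_prep` (P3) of crux `HawkingExtensionIsKerr`, line `SketchIdeator2`

Pure bookkeeping for the rotating branch of the lead skeleton.  Data: the stationary Killing field
`T = 𝓑.killing`, a collar Killing field `K` on an open `U ⊇ 𝓔⁺` commuting with `T`, nowhere zero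
on and tangent to `𝓔⁺` with `∇_K K = κ K` there (`κ ≠ 0`), a Killing field `K'` of the (open)
d.o.c. with `K' = K` on `U' ∩ ⟨⟨M_ext⟩⟩` (`U' ⊇ 𝓔⁺` open), commuting with `T` and not a constant
multiple of `T` on the d.o.c., and constants `a, b ≠ 0`.  Conclusions:

* `Φ := a • T + b • K'` is a Killing field of the d.o.c. (linear combinations of Killing fields
  on an open set, `IsKillingFieldOn.smul` and the additive analogue proved here), commutes with
  `T` (`[T, a T + b K'] = b [T, K'] = 0`, `mlieBracket_combination_right`), and is not identically
  zero on the d.o.c. (else `K' = -(a/b) T` there);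
* `U ∩ U'` is an open neighbourhood of `𝓔⁺` on which `χ := (-(b/a)) • K` is Killing, with
  `χ = T + (-a⁻¹) • Φ` on `(U ∩ U') ∩ ⟨⟨M_ext⟩⟩` (module algebra, `K' = K` there);
* `χ ≠ 0` on `𝓔⁺`, the integral curves of `χ` from `𝓔⁺` stay in `𝓔⁺` (they are reparametrised
  integral curves `t ↦ γ(ct)` of `K`, Mathlib `IsMIntegralCurve.comp_mul`), and
  `∇_χ χ = (-(b/a) κ) χ` on `𝓔⁺` (`∇(cK) = c ∇K`, `IsCovariantDerivativeOn.smul_const`), with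
  `-(b/a) κ ≠ 0` — the rescaling pattern of
  `ZeroEnergyRigidity.Negative.isNonDegenerateHorizon_witness_smul` for a Killing field on an
  open set instead of a global one.
-/

noncomputable section

set_option linter.dupNamespace false

namespace Summit.FinalStateConjecture.FinalStateConjecture.Theorems.HawkingExtensionIsKerr.SketchIdeator2

open Set Function Bundle Literature.Geometry.Lorentzian
open scoped Manifold ContDiff Topology

section LocalKillingAlgebra

variable {E : Type*} [NormedAddCommGroup E] [NormedSpace ℝ E] {H : Type*} [TopologicalSpace H]
  {I : ModelWithCorners ℝ E H} {M : Type*} [TopologicalSpace M] [ChartedSpace H M]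
  [IsManifold I ∞ M] {n : ℕ∞ω} [Fact (1 ≤ n)]

/-- **Sums of Killing fields on an open set are Killing there**: `X + Y` is `C^n` on `U` and
`∇(X + Y) = ∇X + ∇Y` at the points of the open set `U`, where both sections are differentiable
(Mathlib's `IsCovariantDerivativeOn.add`), so the Killing equation adds.  O'Neill 1983, Ch. 9,
remark (1) before Lemma 9.28 (linear combinations of Killing fields are Killing), on the open
submanifold `U`; local form of `IsKillingField.add`. [folklore] -/
private theorem stub_axialCollar_prep_isKillingFieldOn_add
    {g : PseudoRiemannianMetric I n E (TangentSpace I : M → Type _)} [g.HasLeviCivita]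
    {X Y : Π x : M, TangentSpace I x} {U : Set M} (hX : g.IsKillingFieldOn X U)
    (hY : g.IsKillingFieldOn Y U) (hU : IsOpen U) : g.IsKillingFieldOn (X + Y) U := by
  refine ⟨hX.1.add_section hY.1, fun x hx Y₀ Z₀ ↦ ?_⟩
  have hXx : MDiffAt (T% X) x := hX.mdifferentiableAt hU hx
  have hYx : MDiffAt (T% Y) x := hY.mdifferentiableAt hU hx
  have hs : g.leviCivita (X + Y) x = g.leviCivita X x + g.leviCivita Y x :=
    g.leviCivita.isCovariantDerivativeOnUniv.add hXx hYx
  have h₁ := hX.val_leviCivita_add hx Y₀ Z₀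
  have h₂ := hY.val_leviCivita_add hx Y₀ Z₀
  simp only [hs, add_apply, map_add]
  linear_combination h₁ + h₂

/-- **Constant linear combinations of Killing fields on an open set are Killing there**
(`IsKillingFieldOn.smul` and `stub_axialCollar_prep_isKillingFieldOn_add`).  O'Neill 1983, Ch. 9,
remark (1) before Lemma 9.28, on the open submanifold `U`. [folklore] -/
private theorem stub_axialCollar_prep_isKillingFieldOn_combination
    {g : PseudoRiemannianMetric I n E (TangentSpace I : M → Type _)} [g.HasLeviCivita]
    {X Y : Π x : M, TangentSpace I x} {U : Set M} (hX : g.IsKillingFieldOn X U)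
    (hY : g.IsKillingFieldOn Y U) (hU : IsOpen U) (a b : ℝ) :
    g.IsKillingFieldOn (a • X + b • Y) U :=
  stub_axialCollar_prep_isKillingFieldOn_add (hX.smul hU a) (hY.smul hU b) hU

/-- **`[T, a T + b Y] = 0` where `[T, Y] = 0`** (for sections differentiable at the point):
`[T, a T + b Y] = a [T, T] + b [T, Y] = b [T, Y]` (bilinearity of the Lie bracket, Mathlib
`VectorField.mlieBracket_add_right`, `mlieBracket_const_smul_right`, `mlieBracket_self`; cf.
`mlieBracket_combination_right`).  O'Neill 1983, Ch. 1, Lemma 18. [folklore] -/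
private theorem stub_axialCollar_prep_mlieBracket_combination_eq_zero [CompleteSpace E]
    {T Y : Π x : M, TangentSpace I x} {x : M} (hT : MDiffAt (T% T) x) (hY : MDiffAt (T% Y) x)
    (hTY : VectorField.mlieBracket I T Y x = 0) (a b : ℝ) :
    VectorField.mlieBracket I T (a • T + b • Y) x = 0 := by
  rw [VectorField.mlieBracket_add_right hT.smul_const_section hY.smul_const_section,
    VectorField.mlieBracket_const_smul_right hT, VectorField.mlieBracket_const_smul_right hY,
    VectorField.mlieBracket_self, hTY, Pi.zero_apply, smul_zero, smul_zero, add_zero]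

omit [IsManifold I ∞ M] in
/-- **Integral curves of `c • V` from `S` stay in `S` if those of `V` do** (`c ≠ 0`): an integral
curve `γ` of `c • V` is `t ↦ δ(ct)` for the integral curve `δ = γ ∘ (· * c⁻¹)` of `V` (Mathlib
`IsMIntegralCurve.comp_mul`).  Lee, *Introduction to Smooth Manifolds*, Lemma 9.3 (rescaling
lemma). [folklore] -/
private theorem stub_axialCollar_prep_mem_of_isMIntegralCurve_smul
    {V : Π x : M, TangentSpace I x} {S : Set M}
    (htan : ∀ γ : ℝ → M, IsMIntegralCurve γ V → γ 0 ∈ S → ∀ t, γ t ∈ S) {c : ℝ} (hc : c ≠ 0)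
    {γ : ℝ → M} (hγ : IsMIntegralCurve γ (c • V)) (h0 : γ 0 ∈ S) (t : ℝ) : γ t ∈ S := by
  have hγ' : IsMIntegralCurve (γ ∘ (· * c⁻¹)) V := by
    have h := hγ.comp_mul c⁻¹
    rwa [smul_smul, inv_mul_cancel₀ hc, one_smul] at h
  have h := htan _ hγ' (by simpa using h0) (t * c)
  simpa [mul_assoc, mul_inv_cancel₀ hc] using h

/-- **`∇_{cK}(cK) = (cκ) (cK)` where `∇_K K = κ K`** for a Killing field `K` on an open set
`U ∋ p`: `∇(c • K) = c • ∇K` at `p` (`IsCovariantDerivativeOn.smul_const`, `K` differentiable at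
`p`) and linearity in the direction.  Chruściel–Costa 2008, §2.3 ((2.8): the surface gravity
scales with the normalisation of the Killing field). [folklore] -/
private theorem stub_axialCollar_prep_leviCivita_smul_apply
    {g : PseudoRiemannianMetric I n E (TangentSpace I : M → Type _)} [g.HasLeviCivita]
    {K : Π x : M, TangentSpace I x} {U : Set M} (hK : g.IsKillingFieldOn K U) (hU : IsOpen U)
    {p : M} (hp : p ∈ U) {κ : ℝ} (hgeod : g.leviCivita K p (K p) = κ • K p) (c : ℝ) :
    g.leviCivita (c • K) p ((c • K) p) = (c * κ) • (c • K) p := by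
  have hKd : MDiffAt (T% K) p := hK.mdifferentiableAt hU hp
  have hs : g.leviCivita (c • K) p = c • g.leviCivita K p :=
    g.leviCivita.isCovariantDerivativeOnUniv.smul_const c hKd
  rw [hs, Pi.smul_apply, smul_apply, map_smul, hgeod, smul_smul, smul_smul, smul_smul]
  congr 1
  ring

end LocalKillingAlgebra

/-- **Stub P3 (worker): the rotating-branch data for the d.o.c.-level CCH12 fact.**  With
`Φ := a T + b K'` (`a, b ≠ 0`): `Φ` is a Killing field of the d.o.c. commuting with `T`, non-trivial
there (else `K' ∈ ℝ T` on the d.o.c.); the rescaled collar field `χ := (-(b / a)) • K` is Killing on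
`U ∩ U'`, equals `T + Ω Φ` with `Ω = -a⁻¹` on `(U ∩ U') ∩ doc`, is nowhere zero on and tangent to
`𝓔⁺`, and satisfies `∇_χ χ = κ' χ` on `𝓔⁺` with `κ' = -(b / a) * κ ≠ 0` (rescaling pattern of
`Negative.isNonDegenerateHorizon_witness_smul`). -/
theorem stub_axialCollar_prep :
    ∀ (𝓑 : StationaryAFBlackHole.{0}) [𝓑.metric.HasLeviCivita]
      (U U' : Set 𝓑.carrier) (K K' : Π x : 𝓑.carrier, TangentSpace (𝓡 4) x) (a b κ : ℝ),
      IsOpen U → 𝓑.horizon ⊆ U → 𝓑.metric.toPseudoRiemannianMetric.IsKillingFieldOn K U →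
      (∀ x ∈ U, VectorField.mlieBracket (𝓡 4) 𝓑.killing K x = 0) →
      (∀ p ∈ 𝓑.horizon, K p ≠ 0) →
      (∀ γ : ℝ → 𝓑.carrier, IsMIntegralCurve γ K → γ 0 ∈ 𝓑.horizon → ∀ t, γ t ∈ 𝓑.horizon) →
      IsOpen U' → 𝓑.horizon ⊆ U' → (∀ x ∈ U' ∩ 𝓑.doc, K' x = K x) →
      𝓑.metric.toPseudoRiemannianMetric.IsKillingFieldOn K' 𝓑.doc →
      (∀ x ∈ 𝓑.doc, VectorField.mlieBracket (𝓡 4) 𝓑.killing K' x = 0) →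
      (¬ ∃ c : ℝ, ∀ x ∈ 𝓑.doc, K' x = c • 𝓑.killing x) →
      a ≠ 0 → b ≠ 0 → κ ≠ 0 →
      (∀ p ∈ 𝓑.horizon, 𝓑.metric.leviCivita K p (K p) = κ • K p) →
      𝓑.metric.toPseudoRiemannianMetric.IsKillingFieldOn (a • 𝓑.killing + b • K') 𝓑.doc ∧
      (∀ x ∈ 𝓑.doc, VectorField.mlieBracket (𝓡 4) 𝓑.killing (a • 𝓑.killing + b • K') x = 0) ∧
      (∃ x ∈ 𝓑.doc, (a • 𝓑.killing + b • K') x ≠ 0) ∧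
      IsOpen (U ∩ U') ∧ 𝓑.horizon ⊆ U ∩ U' ∧
      𝓑.metric.toPseudoRiemannianMetric.IsKillingFieldOn ((-(b / a)) • K) (U ∩ U') ∧
      (∀ x ∈ (U ∩ U') ∩ 𝓑.doc,
        ((-(b / a)) • K) x = 𝓑.killing x + (-a⁻¹) • (a • 𝓑.killing + b • K') x) ∧
      (∀ p ∈ 𝓑.horizon, ((-(b / a)) • K) p ≠ 0) ∧
      (∀ γ : ℝ → 𝓑.carrier, IsMIntegralCurve γ ((-(b / a)) • K) → γ 0 ∈ 𝓑.horizon →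
        ∀ t, γ t ∈ 𝓑.horizon) ∧
      (-(b / a) * κ ≠ 0) ∧
      (∀ p ∈ 𝓑.horizon, 𝓑.metric.leviCivita ((-(b / a)) • K) p (((-(b / a)) • K) p) =
        (-(b / a) * κ) • ((-(b / a)) • K) p) := by
  intro 𝓑 _ U U' K K' a b κ hU hHU hKon _hKc hKne hKtan hU' hHU' hK'K hK'on hK'c hrot ha hb hκ hκK
  -- the d.o.c. is open; `T` is a global Killing field
  have hdoc : IsOpen 𝓑.doc :=
    𝓑.isOpen_doc LorentzianMetric.isOpen_chronologicalFuture_holds_of_boundaryless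
      LorentzianMetric.isOpen_chronologicalPast_holds_of_boundaryless
  have hT : 𝓑.metric.IsKillingField 𝓑.killing := 𝓑.isStationaryKilling.isKillingField
  have hc : -(b / a) ≠ 0 := neg_ne_zero.mpr (div_ne_zero hb ha)
  refine ⟨stub_axialCollar_prep_isKillingFieldOn_combination (hT.isKillingFieldOn 𝓑.doc) hK'on
      hdoc a b, fun x hx ↦ ?_, ?_, hU.inter hU', subset_inter hHU hHU',
    (hKon.mono inter_subset_left).smul (hU.inter hU') (-(b / a)), fun x hx ↦ ?_,
    fun p hp ↦ ?_,
    fun γ hγ h0 t ↦ stub_axialCollar_prep_mem_of_isMIntegralCurve_smul hKtan hc hγ h0 t,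
    mul_ne_zero hc hκ,
    fun p hp ↦ stub_axialCollar_prep_leviCivita_smul_apply hKon hU (hHU hp) (hκK p hp) _⟩
  · -- `[T, a T + b K'] = b [T, K'] = 0` on the d.o.c.
    exact stub_axialCollar_prep_mlieBracket_combination_eq_zero (hT.mdifferentiableAt x)
      (hK'on.mdifferentiableAt hdoc hx) (hK'c x hx) a b
  · -- `Φ ≢ 0` on the d.o.c., else `K' = -(a/b) T` there
    by_contra hΦ
    push Not at hΦ
    refine hrot ⟨-(a / b), fun x hx ↦ ?_⟩
    have h0 : a • 𝓑.killing x + b • K' x = 0 := by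
      simpa only [Pi.add_apply, Pi.smul_apply] using hΦ x hx
    have h1 : K' x = b⁻¹ • (b • K' x) := by rw [smul_smul, inv_mul_cancel₀ hb, one_smul]
    rw [h1, eq_neg_of_add_eq_zero_right h0, smul_neg, smul_smul, ← neg_smul, div_eq_inv_mul]
  · -- `χ = T + (-a⁻¹) • Φ` on `(U ∩ U') ∩ doc`, where `K' = K`
    simp only [Pi.smul_apply, Pi.add_apply, hK'K x ⟨hx.1.2, hx.2⟩, smul_add, smul_smul]
    rw [neg_mul, inv_mul_cancel₀ ha, neg_one_smul, add_neg_cancel_left, neg_mul,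
      ← div_eq_inv_mul]
  · -- `χ ≠ 0` on `𝓔⁺`
    rw [Pi.smul_apply]
    exact smul_ne_zero hc (hKne p hp)

end Summit.FinalStateConjecture.FinalStateConjecture.Theorems.HawkingExtensionIsKerr.SketchIdeator2

end
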